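import Summits.ResolutionOfSingularities.ResolutionOfSingularities.Theorems.EquisingularLiftEquisingularLiftNatEquinodalCoreSOfCores2
import HarnessLib

/-!
# [OURS · L1 W4.5(b) · EL♮(3) · door ν4, brick N-0 (JINIT at `RD := RPlus`), core S4 of ✓ `coreS_of_cores₂`] THE MARKED CLOSED POINTS ARE PAIRWISE
# DISTINCT — ★ `marked_points_injective` (the `Function.Injective w` conjunct of `cores`)

res-L1-w45b-nose-w1 g4 (WIDTH seat D-0157 DOOR 1; N-0 owner).  DEF-FREE; no `sorry`; standard axioms.  `--supports stmt-ResolutionOfSingularities-20148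
--as helper`, counted 0.

WHAT.  Binders = the binder list of the hypothesis `cores` of ✓ `coreS_of_cores₂` VERBATIM; conclusion = its second conjunct `Function.Injective w`.
PROOF.  `i ≠ i'` ⇒ `vᵢ ≠ vᵢ'` (`Function.Injective v`, a binder of `cores`) with `vᵢ c = vᵢ' c = 1` ⇒ some coordinate `j₀` differs ⇒ the
`O`-form `m̃ := σ̃ (y_{j₀} − nO i j₀ · y_c)` on `ℙ³_O` vanishes at `B̃·nO i` (`(ψ̃ m̃)(nO i) = 0`) and takes the UNIT value `nO i' j₀ − nO i j₀` at `B̃·nO i'`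
(✓ `eval_aeval_linear`, homogeneity scaling); the support dictionary ✓ `SectionOfVec.sectionOfVec_closedPoint_mem_support_iff` then puts `𝔰 i 𝔪` inside and
`𝔰 i' 𝔪` outside `supp (m̃)~`, so `Proj φ (w i) ≠ Proj φ (w i')`.  EL♮(3) is NOT proved; resolution in positive characteristic is NOT proved.
-/

set_option linter.dupNamespace false -- mandated namespace `Summit.<Summit>.<Problem>` of this single-conjunct summit
set_option linter.overlappingInstances false -- signatures carry `[IsDomain O] [IsDiscreteValuationRing O]`

noncomputable section

open CategoryTheory CategoryTheory.Limits AlgebraicGeometry TopologicalSpace Topology IsLocalRing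
open MvPolynomial
open Literature.AlgebraicGeometry.Resolution
open AlgebraicGeometry.Scheme.IdealSheafData
open Summit.ResolutionOfSingularities.ResolutionOfSingularities.Theses.EquisingularLift.Split
open Summit.ResolutionOfSingularities.ResolutionOfSingularities.Cruxes.EquisingularLift.StrataSplit

namespace Summit.ResolutionOfSingularities.ResolutionOfSingularities.Cruxes.EquisingularLiftNat.Sections.Equinodal

/-- ★ **CORE S4 OF `coreS_of_cores₂`: the marked closed points `w i` are pairwise distinct.**  See the module docstring. [OURS · brick N-0 · core S4; counted 0] -/
theorem marked_points_injective (k : Type) [Field k] [IsAlgClosed k] :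
    ∀ (O : Type) [CommRing O] [IsDomain O] [IsDiscreteValuationRing O] [IsAdicComplete (IsLocalRing.maximalIdeal O) O]
        [IsAlgClosed (IsLocalRing.ResidueField O)] (θ : O →+* k), Function.Surjective θ →
      (letI := MvPolynomial.gradedAlgebra (σ := Fin (3 + 1)) (R := O); letI := MvPolynomial.gradedAlgebra (σ := Fin (3 + 1)) (R := k);
       ∀ (φ : MvPolynomial.homogeneousSubmodule (Fin (3 + 1)) O →+*ᵍ MvPolynomial.homogeneousSubmodule (Fin (3 + 1)) k)
        (hφ' : HomogeneousIdeal.irrelevant (MvPolynomial.homogeneousSubmodule (Fin (3 + 1)) k) ≤ (HomogeneousIdeal.irrelevant (MvPolynomial.homogeneousSubmodule (Fin (3 + 1)) O)).map φ), (∀ s, φ s = MvPolynomial.map θ s) →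
        AlgebraicGeometry.IsIntegral (AlgebraicGeometry.Proj (MvPolynomial.homogeneousSubmodule (Fin (3 + 1)) O)) → IsLocallyNoetherian (AlgebraicGeometry.Proj (MvPolynomial.homogeneousSubmodule (Fin (3 + 1)) O)) → Literature.AlgebraicGeometry.Resolution.Scheme.IsRegular (AlgebraicGeometry.Proj (MvPolynomial.homogeneousSubmodule (Fin (3 + 1)) O)) → AlgebraicGeometry.IsProper (AlgebraicGeometry.Proj.toSpecZero (MvPolynomial.homogeneousSubmodule (Fin (3 + 1)) O) ≫ AlgebraicGeometry.Spec.map (CommRingCat.ofHom (algebraMap O (MvPolynomial.homogeneousSubmodule (Fin (3 + 1)) O 0)))) → AlgebraicGeometry.SmoothOfRelativeDimension 3 (AlgebraicGeometry.Proj.toSpecZero (MvPolynomial.homogeneousSubmodule (Fin (3 + 1)) O) ≫ AlgebraicGeometry.Spec.map (CommRingCat.ofHom (algebraMap O (MvPolynomial.homogeneousSubmodule (Fin (3 + 1)) O 0)))) →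
      -- the door's `ℓ`, `Z` and the CERTIFICATE data (`EqCertAt₀ k 3 ℓ Z hZ` unpacked)
      ∀ (ℓ : MvPolynomial (Fin (3 + 1)) k) (Z : Set (Literature.AlgebraicGeometry.Motives.projectiveSpace 3 k).left) (hZ : IsClosed Z) (e δ : ℕ) (g : MvPolynomial (Fin (3 + 1)) k)
        (B : Fin (3 + 1) → Fin 3 → k) (c a b : Fin 3) (v : Fin δ → Fin 3 → k) (r : Fin 3 → Fin (3 + 1)),
        g.IsHomogeneous e → Squarefree (restrictToHyperplane B g) →
        Z = {y : (Literature.AlgebraicGeometry.Motives.projectiveSpace 3 k).left | ℓ ∈ (y : ProjectiveSpectrum (MvPolynomial.homogeneousSubmodule (Fin (3 + 1)) k)).asHomogeneousIdeal ∧ g ∈ (y : ProjectiveSpectrum (MvPolynomial.homogeneousSubmodule (Fin (3 + 1)) k)).asHomogeneousIdeal} →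
        restrictToHyperplane B ℓ = 0 → Function.Injective r → ((c : ℕ) = 2 ∧ (a : ℕ) = 0 ∧ (b : ℕ) = 1) →
        (∀ i, v i c = 1 ∧ MvPolynomial.eval (v i) (restrictToHyperplane B g) = 0 ∧
          (∀ j, MvPolynomial.eval (v i) (MvPolynomial.pderiv j (restrictToHyperplane B g)) = 0) ∧ hessBlock (restrictToHyperplane B g) a b (v i) ≠ 0) →
        (∀ z : ↥(redSub (Literature.AlgebraicGeometry.Motives.projectiveSpace 3 k).left Z hZ), IsClosed ({z} : Set ↥(redSub (Literature.AlgebraicGeometry.Motives.projectiveSpace 3 k).left Z hZ)) → ¬ IsRegularLocalRing ((redSub (Literature.AlgebraicGeometry.Motives.projectiveSpace 3 k).left Z hZ).presheaf.stalk z) →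
          ∃ i, IsCoordVecOf k 3 (fun s => ∑ j, B s j * v i j) (redSubι (Literature.AlgebraicGeometry.Motives.projectiveSpace 3 k).left Z hZ z : (Literature.AlgebraicGeometry.Motives.projectiveSpace 3 k).left)) →
        Function.Injective v →
      -- the LIFTED HYPERPLANE data (✓ `HyperplaneLift.exists_hyperplane_lift`)
      ∀ (a₀ : Fin (3 + 1)) (Bt : Fin (3 + 1) → Fin 3 → O) (ct : Fin (3 + 1) → O) (Nt : Fin 3 → Fin 3 → O),
        (∀ j, r j ≠ a₀) → (∀ a' j, θ (Bt a' j) = B a' j) → IsUnit (Matrix.of fun j j' : Fin 3 => Bt (r j) j').det → ct a₀ = 1 →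
        MvPolynomial.aeval (fun a' : Fin (3 + 1) => ∑ j : Fin 3, MvPolynomial.C (Bt a' j) * MvPolynomial.X j) (∑ a, MvPolynomial.C (ct a) * MvPolynomial.X a : MvPolynomial (Fin (3 + 1)) O) = 0 →
        (∀ G : MvPolynomial (Fin 3) O, MvPolynomial.aeval (fun a' : Fin (3 + 1) => ∑ j : Fin 3, MvPolynomial.C (Bt a' j) * MvPolynomial.X j)
          (MvPolynomial.aeval (fun i : Fin 3 => ∑ j : Fin 3, MvPolynomial.C (Nt i j) * MvPolynomial.X (r j)) G) = G) →
        (∀ f : MvPolynomial (Fin (3 + 1)) O, MvPolynomial.aeval (fun a' : Fin (3 + 1) => ∑ j : Fin 3, MvPolynomial.C (Bt a' j) * MvPolynomial.X j) f = 0 → (∑ a, MvPolynomial.C (ct a) * MvPolynomial.X a : MvPolynomial (Fin (3 + 1)) O) ∣ f) →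
        {y : (Literature.AlgebraicGeometry.Motives.projectiveSpace 3 k).left | ℓ ∈ (y : ProjectiveSpectrum (MvPolynomial.homogeneousSubmodule (Fin (3 + 1)) k)).asHomogeneousIdeal} = {y : (Literature.AlgebraicGeometry.Motives.projectiveSpace 3 k).left | (∑ a', MvPolynomial.C (θ (ct a')) * MvPolynomial.X a' : MvPolynomial (Fin (3 + 1)) k) ∈ (y : ProjectiveSpectrum (MvPolynomial.homogeneousSubmodule (Fin (3 + 1)) k)).asHomogeneousIdeal} →
      -- the EQUINODAL LIFT (✓ `exists_equinodal_lift_of_cert_of_surjective`)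
      ∀ (Gt : MvPolynomial (Fin 3) O) (nO : Fin δ → Fin 3 → O),
        Gt.IsHomogeneous e → MvPolynomial.map θ Gt = restrictToHyperplane B g → (∀ i j, θ (nO i j) = v i j) → (∀ i, nO i 2 = 1) →
        (∀ i, MvPolynomial.eval (nO i) Gt = 0 ∧ ∀ j, MvPolynomial.eval (nO i) (MvPolynomial.pderiv j Gt) = 0) →
        (∀ i, IsUnit (MvPolynomial.eval (nO i) (MvPolynomial.pderiv 0 (MvPolynomial.pderiv 0 Gt)) * MvPolynomial.eval (nO i) (MvPolynomial.pderiv 1 (MvPolynomial.pderiv 1 Gt))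
          - MvPolynomial.eval (nO i) (MvPolynomial.pderiv 0 (MvPolynomial.pderiv 1 Gt)) ^ 2)) →
      -- the two models' degree certificates (so the ideal sheaves below are well-formed)
      ∀ (hL : ∀ l, (![(∑ a, MvPolynomial.C (ct a) * MvPolynomial.X a : MvPolynomial (Fin (3 + 1)) O)] : Fin 1 → MvPolynomial (Fin (3 + 1)) O) l ∈ MvPolynomial.homogeneousSubmodule (Fin (3 + 1)) O ((![1] : Fin 1 → ℕ) l))
        (hF : ∀ l, (![(∑ a, MvPolynomial.C (ct a) * MvPolynomial.X a : MvPolynomial (Fin (3 + 1)) O), (MvPolynomial.aeval (fun i : Fin 3 => ∑ j : Fin 3, MvPolynomial.C (Nt i j) * MvPolynomial.X (r j)) Gt : MvPolynomial (Fin (3 + 1)) O)] : Fin 2 → MvPolynomial (Fin (3 + 1)) O) l ∈ MvPolynomial.homogeneousSubmodule (Fin (3 + 1)) O ((![1, e] : Fin 2 → ℕ) l)),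
      -- the NODE SECTIONS `𝔰 i = [av i]`, `av i = uᵢ⁻¹ • B̃·nO i` (✓ SectionOfVec), and the marked closed points `w i`
      ∀ (av : Fin δ → Fin (3 + 1) → O) (dv : Fin δ → Fin (3 + 1)) (hav : ∀ i, av i (dv i) = 1),
        (∀ i, ∃ u : O, IsUnit u ∧ ∀ a', u * av i a' = ∑ j : Fin 3, Bt a' j * nO i j) →
      ∀ (𝔰 : Fin δ → (AlgebraicGeometry.Spec (.of O) ⟶ (AlgebraicGeometry.Proj (MvPolynomial.homogeneousSubmodule (Fin (3 + 1)) O)))),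
        (∀ i, 𝔰 i = (AlgebraicGeometry.Spec.map (CommRingCat.ofHom ((Localization.awayLift (MvPolynomial.eval (av i)) (MvPolynomial.X (dv i) : MvPolynomial (Fin (3 + 1)) O)
            (SectionOfVec.isUnit_eval_X (av i) (dv i) (hav i))).comp
          (algebraMap (HomogeneousLocalization.Away (MvPolynomial.homogeneousSubmodule (Fin (3 + 1)) O) (MvPolynomial.X (dv i) : MvPolynomial (Fin (3 + 1)) O))
            (Localization.Away (MvPolynomial.X (dv i) : MvPolynomial (Fin (3 + 1)) O))))) ≫
          AlgebraicGeometry.Proj.awayι (MvPolynomial.homogeneousSubmodule (Fin (3 + 1)) O) (MvPolynomial.X (dv i)) (MvPolynomial.isHomogeneous_X O (dv i)) one_pos)) →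
      ∀ (w : Fin δ → (Literature.AlgebraicGeometry.Motives.projectiveSpace 3 k).left), (∀ i, (AlgebraicGeometry.Proj.map φ hφ' : (Literature.AlgebraicGeometry.Motives.projectiveSpace 3 k).left ⟶ (AlgebraicGeometry.Proj (MvPolynomial.homogeneousSubmodule (Fin (3 + 1)) O))) (w i) = 𝔰 i (IsLocalRing.closedPoint O)) →
      Function.Injective w) := by
  classical
  intro O _ _ _ _ _ θ hθ
  letI := MvPolynomial.gradedAlgebra (σ := Fin (3 + 1)) (R := O)
  letI := MvPolynomial.gradedAlgebra (σ := Fin (3 + 1)) (R := k)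
  intro φ hφ' hφ hPint hPnoeth hPreg hqprop hqsm ℓ Z hZ e δ g B c a b v r hg hsq hZeq hℓB hr hcab hmarked hcover hvinj a₀ Bt ct Nt ha₀ hBt
    hdett hcta₀ hψt hsect hkert hVlin Gt nO hGt hGtg hnO hn2 hnode hHess hL hF av dv hav hab 𝔰 h𝔰 w hw i i' hii
  by_contra hne
  -- a coordinate where the marked vectors differ
  have hv : v i ≠ v i' := fun hvv => hne (hvinj hvv)
  obtain ⟨j₀, hj₀⟩ : ∃ j₀, v i j₀ ≠ v i' j₀ := by
    by_contra hall
    simp only [not_exists, not_not] at hall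
    exact hv (funext hall)
  have hc2 : c = 2 := Fin.ext hcab.1
  -- the separating form `m̃ = σ̃ (y_{j₀} − nO i j₀ · y_c)` on `ℙ³_O`
  set μ : MvPolynomial (Fin 3) O := X j₀ - C (nO i j₀) * X c with hμ
  have hμ1 : μ ∈ homogeneousSubmodule (Fin 3) O 1 := by
    refine (isHomogeneous_X O j₀).sub ?_
    simpa using (isHomogeneous_C (Fin 3) (nO i j₀)).mul (isHomogeneous_X O c)
  set mt : MvPolynomial (Fin (3 + 1)) O := aeval (fun i₁ : Fin 3 => ∑ j : Fin 3, C (Nt i₁ j) * X (r j)) μ with hmt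
  have hmt1 : ∀ l, (![mt] : Fin 1 → MvPolynomial (Fin (3 + 1)) O) l ∈ homogeneousSubmodule (Fin (3 + 1)) O ((![1] : Fin 1 → ℕ) l) := by
    intro l; fin_cases l
    exact HyperplaneAlg.isHomogeneous_aeval_linear _ (fun i₁ => HyperplaneAlg.isHomogeneous_sum_C_mul_X _ _) μ hμ1
  -- its values at `B̃ · nO i₂`
  have hval : ∀ i₂, MvPolynomial.eval (fun a' => ∑ j : Fin 3, Bt a' j * nO i₂ j) mt = nO i₂ j₀ - nO i j₀ := by
    intro i₂
    rw [hmt, ← eval_aeval_linear Bt (nO i₂), hsect, hμ]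
    simp [hc2, hn2 i₂]
  -- scaling to the normalised vectors
  have hval' : ∀ i₂, ∃ u : O, IsUnit u ∧ u * MvPolynomial.eval (av i₂) mt = nO i₂ j₀ - nO i j₀ := by
    intro i₂
    obtain ⟨u, hu, hua⟩ := hab i₂
    refine ⟨u, hu, ?_⟩
    have hmtdeg : mt ∈ homogeneousSubmodule (Fin (3 + 1)) O 1 := hmt1 0
    have h := eval_smul_of_mem_homogeneousSubmodule mt hmtdeg u (av i₂)
    rw [pow_one] at h
    rw [← h, ← hval i₂]
    exact congrArg (fun x => MvPolynomial.eval x mt) (funext fun a' => hua a')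
  -- support dictionary at the two sections
  have hin : 𝔰 i (IsLocalRing.closedPoint O) ∈ ((projIdealSheaf (homogeneousSubmodule (Fin (3 + 1)) O)
      ⟨Ideal.span (Set.range ![mt]), isHomogeneous_span_of_forall_mem _ _ _ hmt1⟩).support : Set (Proj (homogeneousSubmodule (Fin (3 + 1)) O))) := by
    rw [h𝔰 i]
    refine (SectionOfVec.sectionOfVec_closedPoint_mem_support_iff (av i) (dv i) (hav i) ![mt] ![1] hmt1).mpr fun l => ?_
    fin_cases l
    obtain ⟨u, hu, hue⟩ := hval' i
    rw [sub_self] at hue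
    have : MvPolynomial.eval (av i) mt = 0 := (hu.mul_right_eq_zero).mp hue
    change MvPolynomial.eval (av i) mt ∈ _
    rw [this]; exact Ideal.zero_mem _
  have hout : 𝔰 i' (IsLocalRing.closedPoint O) ∉ ((projIdealSheaf (homogeneousSubmodule (Fin (3 + 1)) O)
      ⟨Ideal.span (Set.range ![mt]), isHomogeneous_span_of_forall_mem _ _ _ hmt1⟩).support : Set (Proj (homogeneousSubmodule (Fin (3 + 1)) O))) := by
    rw [h𝔰 i']
    intro hmem
    have h := (SectionOfVec.sectionOfVec_closedPoint_mem_support_iff (av i') (dv i') (hav i') ![mt] ![1] hmt1).mp hmem 0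
    change MvPolynomial.eval (av i') mt ∈ IsLocalRing.maximalIdeal O at h
    obtain ⟨u, hu, hue⟩ := hval' i'
    have hunit : IsUnit (nO i' j₀ - nO i j₀) := by
      by_contra hnu
      have hm : nO i' j₀ - nO i j₀ ∈ IsLocalRing.maximalIdeal O := hnu
      rw [← ker_eq_maximalIdeal_of_surjective θ hθ, RingHom.mem_ker, map_sub, hnO, hnO, sub_eq_zero] at hm
      exact hj₀ hm.symm
    rw [← hue] at hunit
    exact (IsLocalRing.maximalIdeal.isMaximal O).ne_top
      (Ideal.eq_top_of_isUnit_mem _ (Ideal.mul_mem_left _ u h) hunit)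
  -- contradiction
  apply hout
  rw [← hw i', ← hii, hw i]
  exact hin

end Summit.ResolutionOfSingularities.ResolutionOfSingularities.Cruxes.EquisingularLiftNat.Sections.Equinodal

end
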